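import Summits.ABC.IUTFork.LanaLogLinkLiftingChecks
import HarnessLib

/-!
# L-LANA objects IX sexies: `UniqueLifting` for the GOOD-PLACE reference data (`Π_v` a genuine extension `1 → Δ → Π → G_{ℚ_p} → 1`)

Record-only sequel (D-0012; seat abc-iut-c312-4, L-LANA level, plan/LLANA-SPEC N12) of `LanaLogLinkLifting.lean` /
`LanaLogLinkLiftingChecks.lean`, now for the reference data of `LanaGoodPlace.lean` (gen 0): `RefLocalDatum.ofExtension p E e`
— `K̄_v = ℚ̄_p`, `G_v = Gal(ℚ̄_p/ℚ_p)`, and `Π_v := E.arith` for a profinite extension `E : 1 → Δ → Π → G → 1` of layer L4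
(`FundamentalExtension`, seat abc-iut-L4-t1) with `e : E.gal ⥲ Gal(ℚ̄_p/ℚ_p)`, `Π_v ↠ G_v := e ∘ aug` ("`G_v` … regarded
as a quotient of `Π_v` equipped with an interpretation as a fundamental group", LANA §6 (Ind1) p. 31). This is the
datum for which [IUTchI] Cor. 5.3 (ii) / [AbsTopIII] Prop. 3.2 (iv) are actually invoked (hyperbolic orbicurve type,
as opposed to the mono-analytic `padicRef` of `…Checks.lean` / `…Mono.lean`); TAKES NO SIDE on [IUTchIII] Cor. 3.12.

* `goodModelData E e` — the good-place datum AS model data of [AbsTopIII] Def. 3.1 (i) over `MLFClosure.padic`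
  (`Π_k := E.arith`, `ε_k := e ∘ aug`); `goodPair E e` — LANA's `F_v = (Π_v ↷ O^▷_{ℚ̄_p})` as a Def. 3.1 (ii) pair;
  `goodPairIsoModel` — `F_v ≅` the model `TM`-pair `(Π_k ↷ 𝒪^⊳_{ℚ̄_p})` (same `Π`, `O^▷ = 𝒪^⊳` by
  `intMonoid_eq_nonzeroIntegers`, same action); hence **`isMLFGaloisMonoidPair_goodPair`** — the hypothesis `hMLF` of the
  N12 reduction is a THEOREM for every good-place datum;
* **`good_liftUnique_of_pairIsoDeterminedByGalois`** — the uniqueness half of LANA's unique lifting at every good-place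
  datum follows from [AbsTopIII] Prop. 3.2 (iv) injectivity (`PairIsoDeterminedByGalois`) ALONE;
* `goodPair_actionKer` — the arithmetic kernel of `F_v` IS `Δ = Ker(Π ↠ G)` (faithfulness of `G_{ℚ_p} ↷ O^▷_{ℚ̄_p}`,
  `padicGal_eq_one_of_forall_smul_intMonoid`), so the characteristicity clause `hker` of the existence half reads
  `IsTopCharacteristic Π Δ` — exactly the [AbsAnab] Lem. 1.3.8-type input that [IUTchII] Prop. 1.6 quotes
  ("the [group-theoretic!] subgroup `Δ ⊆ Π`") and that the cell's GAP-LEDGER rows G-w4d010-3 carry for the tempered case;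
* **`good_uniqueLifting_of_named`** — for a family of good-place data: `UniqueLifting` ⟸ `PairIsoDeterminedByGalois` ∧
  `GaloisIsoLiftsToTMPairIso H` (with `H` holding at each datum: "of hyperbolic orbicurve type") ∧ `IsTopCharacteristic Π Δ`
  at each datum ∧ the continuity clause.

[cite: LANA2026Report, §5.3 (a) p. 29, §6 (Ind1) p. 31] [cite: MochizukiAbsTopIII2015, Proposition 3.2 (iv) p.72]
NOT here: any judgement.
-/

noncomputable section

namespace Summit.ABC
namespace IUTFork

open Literature.AnabelianGeometry.AbsoluteAnabelian
open scoped NNReal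

variable (p : ℕ) [Fact p.Prime] (E : FundamentalExtension.{0}) (e : E.gal ≃ₜ* PadicGal p)

/-- **The good-place datum as [AbsTopIII] Def. 3.1 (i) model data** over `(ℚ_p, ℚ̄_p)`: `Π_k := Π = E.arith`,
`ε_k := e ∘ aug : Π ↠ Gal(ℚ̄_p/ℚ_p)` (continuous, surjective). [cite: MochizukiAbsTopIII2015, Definition 3.1 (i) p.66] -/
def goodModelData : ModelMLFGaloisData ℚ_[p] (PadicAlgCl p) where
  Pi := E.arith
  aug := e.toMulEquiv.toMonoidHom.comp E.aug.toMonoidHom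
  continuous_aug := e.continuous.comp (map_continuous E.aug)
  aug_surjective := e.surjective.comp E.aug_surjective

/-- **LANA's good-place `F_v = (Π_v ↷ O^▷_{ℚ̄_p})` as an [AbsTopIII] Def. 3.1 (ii) pair** (open stabilisers from the
`ℚ_p` case: `G_v` and `O^▷` are those of `padicRef`). [cite: MochizukiAbsTopIII2015, Definition 3.1 (ii) p.67]
[cite: LANA2026Report, §3.10 Table 1 p. 22] -/
abbrev goodPair : GaloisMonoidPair.{0} := (RefLocalDatum.ofExtension p E e).toPair (padicRef_stabilizer_isOpen p)

/-- **`F_v ≅` the model `TM`-pair of `goodModelData`**: identity on `Π`, `O^▷_{ℚ̄_p} = 𝒪^⊳_{ℚ̄_p}` on the monoids, the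
same action `g ↦ e(aug g)`. [cite: MochizukiAbsTopIII2015, Definition 3.1 (ii) p.67] -/
def goodPairIsoModel : GaloisMonoidPair.Iso (goodModelData p E e).tmPair (goodPair p E e) where
  isoPi := ContinuousMulEquiv.refl _
  isoM := MulEquiv.submonoidCongr (intMonoid_eq_nonzeroIntegers p).symm
  smul_comm _ _ := Subtype.ext rfl

/-- **The good-place `F_v` is an MLF-Galois `TM`-pair** ([AbsTopIII] Def. 3.1 (ii) over `MLFClosure.padic`): the
hypothesis `hMLF` of `liftUnique_of_pairIsoDeterminedByGalois` / `liftExists_of_galoisIsoLifts` is a THEOREM for EVERY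
`E`, `e`. [cite: MochizukiAbsTopIII2015, Definition 3.1 (ii) p.67] -/
theorem isMLFGaloisMonoidPair_goodPair : IsMLFGaloisMonoidPair .TM (goodPair p E e) :=
  ⟨⟨MLFClosure.padic p, goodModelData p E e, _, (goodModelData p E e).monoidPair_TM, ⟨goodPairIsoModel p E e⟩⟩⟩

/-- **The uniqueness half at every good-place datum follows from [AbsTopIII] Prop. 3.2 (iv), injectivity, ALONE**:
granted `PairIsoDeterminedByGalois`, an automorphism of `F_v = (Π_v ↷ O^▷_{ℚ̄_p})` is determined by its `Π_v`-component.
[cite: MochizukiAbsTopIII2015, Proposition 3.2 (iv) p.72] [cite: LANA2026Report, §5.3 (a) p. 29] -/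
theorem good_liftUnique_of_pairIsoDeterminedByGalois (hdet : PairIsoDeterminedByGalois) :
    (RefLocalDatum.ofExtension p E e).LiftUnique :=
  (RefLocalDatum.ofExtension p E e).liftUnique_of_pairIsoDeterminedByGalois (padicRef_stabilizer_isOpen p)
    (isMLFGaloisMonoidPair_goodPair p E e) hdet

/-- **The arithmetic kernel of the good-place pair is `Δ = Ker(Π ↠ G)`** (`G_{ℚ_p}` acts faithfully on `O^▷_{ℚ̄_p}`,
`padicGal_eq_one_of_forall_smul_intMonoid`; `e` is injective). [cite: MochizukiAbsTopIII2015, Definition 3.1 (ii) p.67]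
[cite: LANA2026Report, §6 (Ind1) p. 31] -/
theorem goodPair_actionKer : (goodPair p E e).actionKer = E.geom := by
  rw [(RefLocalDatum.ofExtension p E e).toPair_actionKer_eq_ker (padicRef_stabilizer_isOpen p)
    (padicGal_eq_one_of_forall_smul_intMonoid p), FundamentalExtension.geom_eq_ker]
  ext g
  rw [MonoidHom.mem_ker, MonoidHom.mem_ker]
  change e (E.aug g) = 1 ↔ E.aug g = 1
  rw [← map_one e, e.injective.eq_iff]

/-- Hence the characteristicity clause `hker` of the existence half is `IsTopCharacteristic Π Δ` ("the [group-theoretic!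
— cf., e.g., [AbsAnab], Lemma 1.3.8] subgroup", [IUTchII] Prop. 1.6). [cite: Mochizuki2012, II Prop 1.6 p.31] -/
theorem goodPair_isTopCharacteristic_iff :
    Literature.AnabelianGeometry.EtaleTheta.IsTopCharacteristic E.arith (goodPair p E e).actionKer ↔
      Literature.AnabelianGeometry.EtaleTheta.IsTopCharacteristic E.arith E.geom := by
  rw [goodPair_actionKer]

/-- **`UniqueLifting` for a family of GOOD-PLACE reference data FROM THE NAMED FACTS** (the `hMLF` hypothesis discharged):
granted [AbsTopIII] Prop. 3.2 (iv) injectivity and bijectivity-for-`H` (`H` = "of hyperbolic orbicurve type", holding at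
each datum), `Δ_v ⊆ Π_v` characteristic at each place, and the continuity clause, LANA's unique lifting of the log-link
holds for the family `v ↦ RefLocalDatum.ofExtension p (E v) (e v)`.
[cite: LANA2026Report, §5.3 (a) p. 29] [cite: MochizukiAbsTopIII2015, Proposition 3.2 (iv) p.72] -/
theorem good_uniqueLifting_of_named {V : Type} (Ev : V → FundamentalExtension.{0})
    (ev : ∀ v, (Ev v).gal ≃ₜ* PadicGal p) {H : GaloisMonoidPair.{0} → Prop}
    (hdet : PairIsoDeterminedByGalois) (hlift : GaloisIsoLiftsToTMPairIso H) (hH : ∀ v, H (goodPair p (Ev v) (ev v)))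
    (hker : ∀ v, Literature.AnabelianGeometry.EtaleTheta.IsTopCharacteristic (Ev v).arith (Ev v).geom)
    (hcont : ∀ v (f : GaloisMonoidPair.Iso (goodPair p (Ev v) (ev v)) (goodPair p (Ev v) (ev v))),
      Continuous f.isoM ∧ Continuous f.isoM.symm) :
    UniqueLifting (fun v => RefLocalDatum.ofExtension p (Ev v) (ev v)) :=
  uniqueLifting_of_ref
    (fun v => (RefLocalDatum.ofExtension p (Ev v) (ev v)).liftExists_of_galoisIsoLifts (padicRef_stabilizer_isOpen p)
      (isMLFGaloisMonoidPair_goodPair p (Ev v) (ev v)) (hH v) hlift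
      ((goodPair_isTopCharacteristic_iff p (Ev v) (ev v)).mpr (hker v)) (hcont v))
    (fun v => good_liftUnique_of_pairIsoDeterminedByGalois p (Ev v) (ev v) hdet)

end IUTFork

end Summit.ABC

end
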